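import Summits.HubbardSuperconductivity.HubbardSuperconductivity.Theorems.DeformationLadderLadderThesisPinnedFrameBloch
import Summits.HubbardSuperconductivity.HubbardSuperconductivity.Theorems.DeformationLadderLadderThesisRigidityReduction
import HarnessLib

/-!
# Crux `LadderThesis` (stmt-HubbardSuperconductivity-1890), line `Sketch` (card `pinned-up-gauge-frame`):
# the stub `stub_condensateBloch` holds — vacuously

The card's declared load-bearing inequality `CondensateBloch` (sketch `Cruxes/LadderThesis/SketchIdeator2.lean`,
Why-it-bites (4)), transcribed into tree vocabulary as the registered stub `stub_condensateBloch` of the line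
skeleton `Cruxes/LadderThesis/Lines/Sketch.lean`, reads: for every `U > 0`, `δ ∈ (0,1/2)`, `σ > 0` there are
`γ > 0`, `L₀` with
`γ · L⁻⁴ Re⟨φ, Δ_dᴴΔ_d φ⟩ - σ ≤ (Re⟨φ, H φ⟩ - E₀) + Re⟨φ, (D_{k₁}ᴴ H D_{k₁} - H) φ⟩`
for all even `L ≥ L₀` and all unit vectors `φ` of the `(N_L, S^z = 0)` sector (`H = hubbardTorus 2 L 1 U`,
`E₀` its sector energy, `D_{k₁} = fockTwist (-(θ_{e₁}))` the flat spin-↑ twist of winding `e₁`).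

**It carries no load.**  The right-hand side telescopes to `Re⟨D_{k₁}φ, H D_{k₁}φ⟩ - E₀`, which is `≥ 0` by the
variational principle because the twist is unitary and preserves the sector (Bloch's theorem in frame form —
the `γ = σ = 0` case the card itself mentions); the left-hand side is `≤ 32 γ - σ` by the a-priori bound
`Re⟨φ, Δ_dᴴΔ_d φ⟩ ≤ 32 L⁴` (`re_expect_pairPenalty_le`).  Hence `γ := σ/32`, `L₀ := 0` witness the statement
for every `U`, `δ`, at every `L` and for every `φ` — the slack `σ` sits OUTSIDE `γ` and the quantifier order is
`∀ σ, ∃ γ`, so the inequality never constrains a condensed state.  (The non-vacuous reading, slack inside: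
`γ · (L⁻⁴ Re⟨Δ_dᴴΔ_d⟩_φ - σ) ≤ …`, is — after conjugation by `D_{k₁}` — the single-mode instance of TwistGap's
open crux `TgPairMomentumRigidity`, stmt-HubbardSuperconductivity-1509.)

References: F. Bloch / D. Bohm, Phys. Rev. 75 (1949) 502 (variational twist inequality); E. Lieb, T. Schultz,
D. Mattis, Ann. Phys. 16 (1961) 407, App. B; H. Tasaki, *Physics and Mathematics of Quantum Many-Body
Systems* (2020) §2.2 (variational principle on a sector).  No definition is introduced.
-/

noncomputable section

namespace Summit.HubbardSuperconductivity.HubbardSuperconductivity.Theorems.DeformationLadder.PinnedFrameLine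

set_option linter.dupNamespace false

open Matrix Complex Literature.MathematicalPhysics.QuantumLattice Literature.Probability.LatticeModels
open Summit.HubbardSuperconductivity.HubbardSuperconductivity.Theorems.PinnedFrame
open scoped ComplexOrder

/-- **Bloch's variational twist inequality, conjugate-frame form.** For every unit vector `ψ` of a joint
sector and every isometry-like `V = fockTwist θ` (here `θ = -θ_k`, the sketch's `upTwist L k`),
`E₀ ≤ Re⟨ψ, Vᴴ H V ψ⟩`: the twisted vector `V ψ` stays in the sector, has unit norm, and is a trial state.
Bohm, Phys. Rev. 75 (1949) 502; Lieb–Schultz–Mattis (1961) App. B; Tasaki (2020) §2.2. [folklore] -/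
theorem minEnergyOn_le_re_conjTranspose_frame (L : ℕ) (U : ℝ) (θ : Orb (FermionTorus 2 L) → ℝ)
    {N : ℕ} {M : ℝ} {ψ : Fock (Orb (FermionTorus 2 L))} (hψ : ψ ∈ szSector N M)
    (hψ1 : star ψ ⬝ᵥ ψ = 1) :
    (hubbardTorus 2 L 1 U).minEnergyOn (szSector N M) ≤
      (star ψ ⬝ᵥ (((fockTwist θ)ᴴ * hubbardTorus 2 L 1 U * fockTwist θ) *ᵥ ψ)).re := by
  have hmem : fockTwist θ *ᵥ ψ ∈ szSector N M := fockTwist_mulVec_mem_szSector _ hψ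
  have h1 : star (fockTwist θ *ᵥ ψ) ⬝ᵥ (fockTwist θ *ᵥ ψ) = 1 := by
    rw [star_mulVec_dotProduct, conjTranspose_fockTwist_mulVec_mulVec, hψ1]
  have h := minEnergyOn_le_rayleigh_of_mem
    (LiebThm1.hamiltonian_isHermitian (fermionTorusGraph 2 L) 1 U) _ hmem h1
  rwa [Matrix.star_mulVec_dotProduct_mulVec] at h

/-- **Stub `stub_condensateBloch` of line `Sketch` (crux stmt-HubbardSuperconductivity-1890) — proved, and
vacuous.** The card's `CondensateBloch` in tree vocabulary: for every `U > 0`, `δ ∈ (0,1/2)`, `σ > 0` there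
are `γ > 0`, `L₀` such that for all even `L ≥ L₀` and every unit vector `φ` of the `(N_L, S^z=0)` sector,
`γ·L⁻⁴ Re⟨φ, Δ_dᴴΔ_d φ⟩ - σ ≤ (Re⟨φ,Hφ⟩ - E₀) + Re⟨φ, (D_{k₁}ᴴ H D_{k₁} - H) φ⟩`,
`D_{k₁} = fockTwist (-(upTwistAngle L e₁))`.  Witnesses: `γ := σ/32`, `L₀ := 0` — the right-hand side is
`Re⟨D_{k₁}φ, H D_{k₁}φ⟩ - E₀ ≥ 0` (`minEnergyOn_le_re_conjTranspose_frame`) and the left-hand side is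
`≤ 32γ - σ = 0` (`re_expect_pairPenalty_le`).  Card `pinned-up-gauge-frame`, Why-it-bites (4);
Bohm (1949); Lieb–Schultz–Mattis (1961) App. B. [folklore] -/
theorem stub_condensateBloch :
    ∀ (U : ℝ), 0 < U → ∀ δ ∈ Set.Ioo (0:ℝ) (1 / 2), ∀ σ : ℝ, 0 < σ → ∃ γ : ℝ, 0 < γ ∧ ∃ L₀ : ℕ,
      ∀ (L : ℕ) [NeZero L], L₀ ≤ L → Even L →
        ∀ φ : Fock (Orb (FermionTorus 2 L)),
          φ ∈ szSector (2 * ⌊(1 - δ) * (L : ℝ) ^ 2 / 2⌋₊) 0 → star φ ⬝ᵥ φ = 1 →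
            γ * ((expect ((pairField dWaveFormFactor L)ᴴ * pairField dWaveFormFactor L) φ).re /
                (L : ℝ) ^ 4) - σ ≤
              ((expect (hubbardTorus 2 L 1 U) φ).re -
                  (hubbardTorus 2 L 1 U).minEnergyOn (szSector (2 * ⌊(1 - δ) * (L : ℝ) ^ 2 / 2⌋₊) 0)) +
                (expect ((fockTwist (-(upTwistAngle L (Pi.single 0 1))))ᴴ * hubbardTorus 2 L 1 U *
                    fockTwist (-(upTwistAngle L (Pi.single 0 1))) - hubbardTorus 2 L 1 U) φ).re := by
  intro U _hU δ _hδ σ hσ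
  refine ⟨σ / 32, by positivity, 0, ?_⟩
  intro L _ _hL _hE φ hφ hφ1
  -- the a-priori bound on the LRO density: `L⁻⁴ Re⟨Δ_dᴴΔ_d⟩_φ ≤ 32`
  have hL0 : (0 : ℝ) < L := Nat.cast_pos.mpr (Nat.pos_of_ne_zero (NeZero.ne L))
  have hL4 : (0 : ℝ) < (L : ℝ) ^ 4 := by positivity
  have hlro : (expect ((pairField dWaveFormFactor L)ᴴ * pairField dWaveFormFactor L) φ).re /
      (L : ℝ) ^ 4 ≤ 32 := by
    rw [div_le_iff₀ hL4]
    exact DeformationLadder.re_expect_pairPenalty_le L hφ1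
  -- Bloch: the frame energy of `φ` is at least the sector energy
  have hframe := minEnergyOn_le_re_conjTranspose_frame L U (-(upTwistAngle L (Pi.single 0 1))) hφ hφ1
  -- the right-hand side telescopes
  have hexp : (expect ((fockTwist (-(upTwistAngle L (Pi.single 0 1))))ᴴ * hubbardTorus 2 L 1 U *
        fockTwist (-(upTwistAngle L (Pi.single 0 1))) - hubbardTorus 2 L 1 U) φ).re =
      (star φ ⬝ᵥ (((fockTwist (-(upTwistAngle L (Pi.single 0 1))))ᴴ * hubbardTorus 2 L 1 U *
        fockTwist (-(upTwistAngle L (Pi.single 0 1)))) *ᵥ φ)).re - (expect (hubbardTorus 2 L 1 U) φ).re := by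
    simp only [expect, sub_mulVec, dotProduct_sub, Complex.sub_re]
  rw [hexp]
  have hγ : σ / 32 * ((expect ((pairField dWaveFormFactor L)ᴴ * pairField dWaveFormFactor L) φ).re /
      (L : ℝ) ^ 4) ≤ σ / 32 * 32 := mul_le_mul_of_nonneg_left hlro (by positivity)
  linarith

end Summit.HubbardSuperconductivity.HubbardSuperconductivity.Theorems.DeformationLadder.PinnedFrameLine
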